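import Summits.FinalStateConjecture.FinalStateConjecture.Theorems.SwallowTheDatumUniversalWitnessFamilyThroatSettlesToo
import Summits.FinalStateConjecture.FinalStateConjecture.Theorems.SwallowTheDatumParametricKerrBurialCollarLine
import HarnessLib

/-!
# Crux `SwallowTheDatum.UniversalWitnessFamily` (stmt-FinalStateConjecture-10051), line `Sketch` — the SHEET LINE
# composition (skeleton v5): `MGHDExists → SubdataDevelopmentsEmbed → farGluing → socketBag → socketDilation →
# socketTransportPatch → sheetBreathing → UniversalWitnessFamily`

Continuation lead c1, 2026-08-16.  The first lead's composition file
`SwallowTheDatumUniversalWitnessFamilyThroatSettlesToo.lean` reduced the crux to the route items `MGHDExists` (9937),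
`SubdataDevelopmentsEmbed` (10053) and the monolithic d-side engine THROAT BURIAL.  Skeleton v5
(`Cruxes/UniversalWitnessFamily/Lines/Sketch.lean`) reshapes that engine along the house pattern of crux 10052's collar
lines (`SwallowTheDatumParametricKerrBurial{Line,CollarLine}.lean`): a receding FAR GLUING of `d` onto an exact
isotropic Schwarzschild(`m_R`) far field (10052's registered `stub_farGluing`, verbatim), ONE d-free analytic atom — the
UNIVERSAL SOCKET BAG (a vacuum datum on `ℝ³` minus the unit ball, exactly weak-field isotropic Schwarzschild(`μ`) on the
socket annulus `{1 < ‖y‖ < 2}` and exactly isotropic Schwarzschild(`M`), `M > 4`, on the open exterior sheet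
`{‖y‖ > M/2}`) — and three geometric steps (dilation; transport-and-patch across the Schwarzschild(`m_R`) annulus;
breathing), after which the landed `junction` lemma reparametrises the result into a typed smooth injective family.

The SHIELD of v5 is the open-sheet presentation that the landed `ThroatSettlesToo.settles_core` consumes: an open
embedding `Φ : {‖y‖ > M/2} → X` with injective differentials and co-compact far zones along which the member pulls back
EXACTLY to `Schwarzschild.timeSymmetricExteriorData M`.  It is stated UNFOLDED everywhere (no new definition).

Content (all proved, pure logic over landed theorems): §1 `settlesInEveryMGHD_ofSheet` — the ∀-MGHD clauses of the summit
conclusion for ONE sheet-shielded member (`SubdataDevelopmentsEmbed` + `settles_core` + the landed levers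
`stub_exteriorTransport`, `stub_scriTransfer`); §2 `sheetBurial_of` — the five stub STATEMENTS of v5 (as hypotheses,
verbatim the registered signatures) give a smooth injective admissible family with sheet-shielded members off `c = 0`
(first-order plumbing + `junction`, verbatim the proof of 10052's `ParametricKerrBurial_of_collarLine`); §3
`universalWitnessFamily_of_sheetLine` — the crux BY NAME from `MGHDExists`, `SubdataDevelopmentsEmbed` and the five
statements.  Nothing is asserted unconditionally about the crux; the file is the certificate that the registered stubs of
v5 close it.
-/

-- `Summit.<Summit>.<Problem>` is the tree's mandated summit-side namespace (CONVENTIONS §2); for this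
-- single-conjunct summit the two coincide, so the duplicate is deliberate.
set_option linter.dupNamespace false

noncomputable section

namespace Summit.FinalStateConjecture.FinalStateConjecture.Theorems.SwallowTheDatum.UniversalWitnessFamily.SheetLine

open scoped Manifold ContDiff Topology
open Bundle Set Filter Function Literature.Geometry.Lorentzian
open Summit.FinalStateConjecture.FinalStateConjecture.Theses.SwallowTheDatum
  (UniversalWitnessFamily MGHDExists SubdataDevelopmentsEmbed)
open Summit.FinalStateConjecture.FinalStateConjecture.Theorems.SwallowTheDatum.ParametricKerrBurial
  (SmoothSectionsOn AgreeAt IsExactSchwarzschildBeyond IsSchwarzschildAnnulus junction VacuumOn IsIsotropicBeyond)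
open Summit.FinalStateConjecture.FinalStateConjecture.Theorems.SwallowTheDatum.UniversalWitnessFamily.ThroatSettlesToo
  (settles_core)

/-! ## §1 One sheet-shielded member settles in every maximal development -/

/-- **The ∀-MGHD clauses of the summit conclusion for ONE sheet-shielded member.**  If `D` on `X` pulls back, along an
open embedding `Φ` of the open exterior sheet `{‖y‖ > M/2}` with injective differentials and co-compact far zones,
EXACTLY to the time-symmetric Schwarzschild exterior data of mass `M > 0`, then in every MAXIMAL vacuum Cauchy development
of `D` future null infinity is complete (sojourn form) and the self-determined exterior carries an exhaustive sub-extremal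
`N = 1` final-state decomposition — from `SubdataDevelopmentsEmbed` (route item 10053) specialised to `Φ`, the landed
generic lever `stub_exteriorTransport`, the landed scri lever `stub_scriTransfer` and the landed `settles_core`.
[folklore] -/
theorem settlesInEveryMGHD_ofSheet (hE : SubdataDevelopmentsEmbed)
    (X : Type) [TopologicalSpace X] [ChartedSpace E3 X] [IsManifold (𝓡 3) ∞ X]
    [T2Space X] [SecondCountableTopology X] [ConnectedSpace X]
    (D : InitialDataSet (𝓡 3) X)
    (hsh : ∃ (M' : ℝ) (hM' : 0 < M') (Φ : Schwarzschild.isotropicExterior M' → X)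
      (hΦ : ContMDiff (𝓡 3) (𝓡 3) (∞ + 1) Φ) (hΦ' : ∀ u, Function.Injective (mfderiv (𝓡 3) (𝓡 3) Φ u)),
      Topology.IsOpenEmbedding Φ ∧
      (∀ R' : ℝ, M' / 2 ≤ R' →
        IsCompact (Φ '' {y : Schwarzschild.isotropicExterior M' | R' < ‖(y : E3)‖})ᶜ) ∧
      D.comap Φ hΦ hΦ' = Schwarzschild.timeSymmetricExteriorData M' hM'.le)
    (𝒟 : VacuumCauchyDevelopment D) (hmax : 𝒟.IsMaximal) :
    Summit.FinalStateConjecture.HasCompleteNullInfinity 𝒟.toCauchyDevelopment ∧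
      ∃ (O : Set 𝒟.carrier) (dec : FinalStateDecomposition 𝒟.toSpacetime O 2),
        (∀ i, Kerr.IsSubextremal (dec.mass i) (dec.spin i)) ∧
          O = Summit.FinalStateConjecture.exteriorOf 𝒟.toCauchyDevelopment dec.charted ∧
            Summit.FinalStateConjecture.HasExhaustiveCharts dec := by
  haveI : Kerr.Facts :=
    ⟨Kerr.isConnected_region_holds, Kerr.contMDiff_bilin_holds, Kerr.contMDiff_timeVector_holds⟩
  obtain ⟨M, hM, Φ', hΦ', hΦ'', hopen, hfar, hdata⟩ := hsh
  exact settles_core 𝒟 hM hopen hfar hdata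
    (hE X D 𝒟 hmax (Schwarzschild.isotropicExterior M) Φ' hΦ' hΦ'' hopen)
    (Summit.FinalStateConjecture.FinalStateConjecture.Theorems.SwallowTheDatum.UniversalWitnessFamily.stub_exteriorTransport
      X D 𝒟.toCauchyDevelopment (Schwarzschild.isotropicExterior M) Φ' hΦ' hΦ'' hopen)
    (Summit.FinalStateConjecture.FinalStateConjecture.Theorems.PhaseMixingCapture.WeakCosmicCensorshipMGHD.stub_scriTransfer
      X D 𝒟.toCauchyDevelopment (Schwarzschild.isotropicExterior M) Φ' hΦ' hΦ'' hopen)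

/-! ## §2 The d-side: the five stub statements give the sheet burial -/

/-- **SHEET BURIAL from the five stub statements of skeleton v5** (hypotheses = the registered signatures verbatim:
FAR GLUING `hA` — Mao–Oh–Tao arXiv:2308.13031 Thm 1.7/1.10 receding far-annulus gluing onto a growing exact isotropic
Schwarzschild seed, smooth in the radius; UNIVERSAL SOCKET BAG `hU`; SOCKET DILATION `hDil`; TRANSPORT-AND-PATCH `hPatch`;
SHEET BREATHING `hBreathe`): far gluing gives `η, e, R⋆, m, G`; the bag at `μ₀ := η/32` gives `μ, M, C` with `32μ ≤ η`;
dilation the family `Cfam`; transport + patch the radius-indexed admissible sheet-shielded family `P` with `P R = d` off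
`e.far R` (`far_mono`); breathing the families `S, E` and the marker; the landed `junction` lemma
(`SwallowTheDatumParametricKerrBurialLine.lean`) the typed family `F`. [folklore] -/
theorem sheetBurial_of :
    (∀ (X : Type) [TopologicalSpace X] [ChartedSpace E3 X] [IsManifold (𝓡 3) ∞ X] [T2Space X]
      [SecondCountableTopology X] [ConnectedSpace X], ∀ d ∈ admissibleVacuumData X,
      ∃ (η : ℝ) (e : AFEnd X) (Rstar : ℝ) (m : ℝ → ℝ) (G : ℝ → InitialDataSet (𝓡 3) X),
        0 < η ∧ e.IsSoleEnd ∧ e.R < Rstar ∧ ContDiff ℝ ∞ m ∧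
        SmoothSectionsOn 𝓘(ℝ, ℝ) G {p : ℝ × X | Rstar < p.1} ∧
        ∀ R : ℝ, Rstar < R → G R ∈ admissibleVacuumData X ∧ (∀ x ∉ e.far R, AgreeAt (G R) d x) ∧
          η * R ≤ m R ∧ IsExactSchwarzschildBeyond e (G R) (m R) (32 * R)) →
    (∀ μ₀ : ℝ, 0 < μ₀ → ∃ μ : ℝ, 0 < μ ∧ μ ≤ μ₀ ∧
      ∃ (M : ℝ) (C : InitialDataSet (𝓡 3) E3), 4 < M ∧
        VacuumOn {y : E3 | 1 < ‖y‖} C ∧ IsSchwarzschildAnnulus C μ ∧ IsIsotropicBeyond M (M / 2) C) →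
    (∀ (C : InitialDataSet (𝓡 3) E3) (μ M : ℝ), 0 < μ → 4 < M →
      VacuumOn {y : E3 | 1 < ‖y‖} C → IsSchwarzschildAnnulus C μ → IsIsotropicBeyond M (M / 2) C →
      ∃ Cfam : ℝ → InitialDataSet (𝓡 3) E3,
        SmoothSectionsOn 𝓘(ℝ, ℝ) Cfam {p : ℝ × E3 | 0 < p.1} ∧
        ∀ l : ℝ, 0 < l →
          VacuumOn {y : E3 | l < ‖y‖} (Cfam l) ∧
          (∀ y : E3, l < ‖y‖ → ‖y‖ < 2 * l →
            (Cfam l).h.inner y = (1 + l * μ / (2 * ‖y‖)) ^ 4 • (innerSL ℝ : E3 →L[ℝ] E3 →L[ℝ] ℝ) ∧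
              (Cfam l).k y = 0) ∧
          IsIsotropicBeyond (l * M) (l * M / 2) (Cfam l)) →
    (∀ (X : Type) [TopologicalSpace X] [ChartedSpace E3 X] [IsManifold (𝓡 3) ∞ X] [T2Space X]
      [SecondCountableTopology X] [ConnectedSpace X] (e : AFEnd X) (Rstar η μ M : ℝ) (m : ℝ → ℝ)
      (G : ℝ → InitialDataSet (𝓡 3) X) (Cfam : ℝ → InitialDataSet (𝓡 3) E3),
      e.IsSoleEnd → e.R < Rstar → 0 < μ → 32 * μ ≤ η → 4 < M → ContDiff ℝ ∞ m →
      SmoothSectionsOn 𝓘(ℝ, ℝ) G {p : ℝ × X | Rstar < p.1} →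
      (∀ R : ℝ, Rstar < R → G R ∈ admissibleVacuumData X ∧ η * R ≤ m R ∧
        IsExactSchwarzschildBeyond e (G R) (m R) (32 * R)) →
      SmoothSectionsOn 𝓘(ℝ, ℝ) Cfam {p : ℝ × E3 | 0 < p.1} →
      (∀ l : ℝ, 0 < l →
        VacuumOn {y : E3 | l < ‖y‖} (Cfam l) ∧
        (∀ y : E3, l < ‖y‖ → ‖y‖ < 2 * l →
          (Cfam l).h.inner y = (1 + l * μ / (2 * ‖y‖)) ^ 4 • (innerSL ℝ : E3 →L[ℝ] E3 →L[ℝ] ℝ) ∧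
            (Cfam l).k y = 0) ∧
        IsIsotropicBeyond (l * M) (l * M / 2) (Cfam l)) →
      ∃ P : ℝ → InitialDataSet (𝓡 3) X, SmoothSectionsOn 𝓘(ℝ, ℝ) P {p : ℝ × X | Rstar < p.1} ∧
        ∀ R : ℝ, Rstar < R → P R ∈ admissibleVacuumData X ∧
          (∃ (M' : ℝ) (hM' : 0 < M') (Φ : Schwarzschild.isotropicExterior M' → X)
            (hΦ : ContMDiff (𝓡 3) (𝓡 3) (∞ + 1) Φ) (hΦ' : ∀ u, Function.Injective (mfderiv (𝓡 3) (𝓡 3) Φ u)),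
            Topology.IsOpenEmbedding Φ ∧
            (∀ R' : ℝ, M' / 2 ≤ R' →
              IsCompact (Φ '' {y : Schwarzschild.isotropicExterior M' | R' < ‖(y : E3)‖})ᶜ) ∧
            (P R).comap Φ hΦ hΦ' = Schwarzschild.timeSymmetricExteriorData M' hM'.le) ∧
          ∀ x ∉ e.far (32 * R), AgreeAt (P R) (G R) x) →
    (∀ (X : Type) [TopologicalSpace X] [ChartedSpace E3 X] [IsManifold (𝓡 3) ∞ X] [T2Space X]
      [SecondCountableTopology X] [ConnectedSpace X] (d : InitialDataSet (𝓡 3) X) (e : AFEnd X) (Rstar : ℝ)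
      (P : ℝ → InitialDataSet (𝓡 3) X), e.R < Rstar →
      SmoothSectionsOn 𝓘(ℝ, ℝ) P {p : ℝ × X | Rstar < p.1} →
      (∀ R : ℝ, Rstar < R → P R ∈ admissibleVacuumData X ∧
        (∃ (M' : ℝ) (hM' : 0 < M') (Φ : Schwarzschild.isotropicExterior M' → X)
          (hΦ : ContMDiff (𝓡 3) (𝓡 3) (∞ + 1) Φ) (hΦ' : ∀ u, Function.Injective (mfderiv (𝓡 3) (𝓡 3) Φ u)),
          Topology.IsOpenEmbedding Φ ∧
          (∀ R' : ℝ, M' / 2 ≤ R' →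
            IsCompact (Φ '' {y : Schwarzschild.isotropicExterior M' | R' < ‖(y : E3)‖})ᶜ) ∧
          (P R).comap Φ hΦ hΦ' = Schwarzschild.timeSymmetricExteriorData M' hM'.le) ∧
        ∀ x ∉ e.far R, AgreeAt (P R) d x) →
      ∃ (S : ℝ × ℝ → InitialDataSet (𝓡 3) X) (E : ℝ → InitialDataSet (𝓡 3) X) (x₀ : X)
        (v₀ : TangentSpace (𝓡 3) x₀),
        SmoothSectionsOn (𝓘(ℝ, ℝ).prod 𝓘(ℝ, ℝ)) S {p : (ℝ × ℝ) × X | Rstar < p.1.1} ∧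
        SmoothSectionsOn 𝓘(ℝ, ℝ) E (Set.univ : Set (ℝ × X)) ∧ E 0 = d ∧
        (∀ R t : ℝ, Rstar < R → ∀ x ∉ e.far R, AgreeAt (S (R, t)) (E t) x) ∧ x₀ ∉ e.far Rstar ∧
        Set.InjOn (fun t : ℝ ↦ (E t).h.inner x₀ v₀ v₀) (Set.Ioo (-1) 1) ∧
        ∀ R t : ℝ, Rstar < R → |t| < 1 → S (R, t) ∈ admissibleVacuumData X ∧
          ∃ (M' : ℝ) (hM' : 0 < M') (Φ : Schwarzschild.isotropicExterior M' → X)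
            (hΦ : ContMDiff (𝓡 3) (𝓡 3) (∞ + 1) Φ) (hΦ' : ∀ u, Function.Injective (mfderiv (𝓡 3) (𝓡 3) Φ u)),
            Topology.IsOpenEmbedding Φ ∧
            (∀ R' : ℝ, M' / 2 ≤ R' →
              IsCompact (Φ '' {y : Schwarzschild.isotropicExterior M' | R' < ‖(y : E3)‖})ᶜ) ∧
            (S (R, t)).comap Φ hΦ hΦ' = Schwarzschild.timeSymmetricExteriorData M' hM'.le) →
    ∀ (X : Type) [TopologicalSpace X] [ChartedSpace E3 X] [IsManifold (𝓡 3) ∞ X]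
      [T2Space X] [SecondCountableTopology X] [ConnectedSpace X],
      ∀ d ∈ admissibleVacuumData X, ∃ F : EuclideanSpace ℝ (Fin 1) → InitialDataSet (𝓡 3) X,
        InitialDataSet.IsSmoothDataFamily 1 F ∧ F 0 = d ∧ Function.Injective F ∧
        (∀ c, F c ∈ admissibleVacuumData X) ∧ ∀ c ≠ 0,
          ∃ (M' : ℝ) (hM' : 0 < M') (Φ : Schwarzschild.isotropicExterior M' → X)
            (hΦ : ContMDiff (𝓡 3) (𝓡 3) (∞ + 1) Φ) (hΦ' : ∀ u, Function.Injective (mfderiv (𝓡 3) (𝓡 3) Φ u)),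
            Topology.IsOpenEmbedding Φ ∧
            (∀ R' : ℝ, M' / 2 ≤ R' →
              IsCompact (Φ '' {y : Schwarzschild.isotropicExterior M' | R' < ‖(y : E3)‖})ᶜ) ∧
            (F c).comap Φ hΦ hΦ' = Schwarzschild.timeSymmetricExteriorData M' hM'.le := by
  intro hA hU hDil hPatch hBreathe X _ _ _ _ _ _ d hd
  obtain ⟨η, e, Rstar, m, G, hη, hsole, heR, hm, hGs, hG⟩ := hA X d hd
  obtain ⟨μ, hμ, hμle, M, C, hM4, hvac, hann, hiso⟩ := hU (η / 32) (by positivity)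
  have h32 : 32 * μ ≤ η := by linarith
  obtain ⟨Cfam, hCs, hCfam⟩ := hDil C μ M hμ hM4 hvac hann hiso
  obtain ⟨P, hPs, hP⟩ := hPatch X e Rstar η μ M m G Cfam hsole heR hμ h32 hM4 hm hGs
    (fun R hR ↦ ⟨(hG R hR).1, (hG R hR).2.2.1, (hG R hR).2.2.2⟩) hCs hCfam
  have hRpos : ∀ R : ℝ, Rstar < R → 0 ≤ R := fun R hR ↦ by linarith [e.R_pos]
  have hPd : ∀ R : ℝ, Rstar < R → P R ∈ admissibleVacuumData X ∧
      (∃ (M' : ℝ) (hM' : 0 < M') (Φ : Schwarzschild.isotropicExterior M' → X)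
        (hΦ : ContMDiff (𝓡 3) (𝓡 3) (∞ + 1) Φ) (hΦ' : ∀ u, Function.Injective (mfderiv (𝓡 3) (𝓡 3) Φ u)),
        Topology.IsOpenEmbedding Φ ∧
        (∀ R' : ℝ, M' / 2 ≤ R' →
          IsCompact (Φ '' {y : Schwarzschild.isotropicExterior M' | R' < ‖(y : E3)‖})ᶜ) ∧
        (P R).comap Φ hΦ hΦ' = Schwarzschild.timeSymmetricExteriorData M' hM'.le) ∧
      ∀ x ∉ e.far R, AgreeAt (P R) d x := by
    intro R hR
    refine ⟨(hP R hR).1, (hP R hR).2.1, fun x hx ↦ ?_⟩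
    have hx' : x ∉ e.far (32 * R) := fun h ↦ hx (e.far_mono (by nlinarith [hRpos R hR]) h)
    obtain ⟨h1, h2⟩ := (hP R hR).2.2 x hx'
    obtain ⟨h3, h4⟩ := (hG R hR).2.1 x hx
    exact ⟨h1.trans h3, h2.trans h4⟩
  obtain ⟨S, E, x₀, v₀, hSs, hEs, hE0, hSE, hx₀, hmark, hgood⟩ := hBreathe X d e Rstar P heR hPs hPd
  obtain ⟨F, hF, hF0, hFinj, hmem⟩ := junction d e Rstar S E x₀ v₀ hSs hEs hE0 hSE hx₀ hmark
  refine ⟨F, hF, hF0, hFinj, fun c ↦ ?_, fun c hc ↦ ?_⟩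
  · by_cases hc : c = 0
    · subst hc; rw [hF0]; exact hd
    · obtain ⟨R, t, hR, ht, hFc⟩ := hmem c hc
      rw [hFc]; exact (hgood R t hR ht).1
  · obtain ⟨R, t, hR, ht, hFc⟩ := hmem c hc
    rw [hFc]; exact (hgood R t hR ht).2

/-! ## §3 The crux by name from the five stub statements and the two route items -/

/-- **The crux `UniversalWitnessFamily` from `MGHDExists` (9937), `SubdataDevelopmentsEmbed` (10053) and the SHEET
BURIAL** (through every admissible datum passes a smooth injective admissible family whose members off `c = 0` are
sheet-shielded — the conclusion of `sheetBurial_of`, i.e. the d-side engine's output in v5 form): `MGHDExists` gives the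
∃-MGHD conjunct and `settlesInEveryMGHD_ofSheet` the ∀-MGHD conjunct of the summit conclusion for every member off
`c = 0`.  The v5 analogue of the first lead's `universalWitnessFamily_of_throatBurial` (sheet shield instead of throat
shield). [folklore] -/
theorem universalWitnessFamily_of_sheetBurial :
    MGHDExists → SubdataDevelopmentsEmbed →
    (∀ (X : Type) [TopologicalSpace X] [ChartedSpace E3 X] [IsManifold (𝓡 3) ∞ X]
      [T2Space X] [SecondCountableTopology X] [ConnectedSpace X],
      ∀ d ∈ admissibleVacuumData X, ∃ F : EuclideanSpace ℝ (Fin 1) → InitialDataSet (𝓡 3) X,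
        InitialDataSet.IsSmoothDataFamily 1 F ∧ F 0 = d ∧ Function.Injective F ∧
        (∀ c, F c ∈ admissibleVacuumData X) ∧ ∀ c ≠ 0,
          ∃ (M' : ℝ) (hM' : 0 < M') (Φ : Schwarzschild.isotropicExterior M' → X)
            (hΦ : ContMDiff (𝓡 3) (𝓡 3) (∞ + 1) Φ) (hΦ' : ∀ u, Function.Injective (mfderiv (𝓡 3) (𝓡 3) Φ u)),
            Topology.IsOpenEmbedding Φ ∧
            (∀ R' : ℝ, M' / 2 ≤ R' →
              IsCompact (Φ '' {y : Schwarzschild.isotropicExterior M' | R' < ‖(y : E3)‖})ᶜ) ∧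
            (F c).comap Φ hΦ hΦ' = Schwarzschild.timeSymmetricExteriorData M' hM'.le) →
    UniversalWitnessFamily := by
  intro hM hE hB X _ _ _ _ _ _ d hd
  obtain ⟨F, hF, h0, hinj, hadm, hsh⟩ := hB X d hd
  refine ⟨F, hF, h0, hinj, hadm, fun c hc ↦ ⟨hM X (F c) (hadm c), ?_⟩⟩
  intro 𝒟 h𝒟
  exact settlesInEveryMGHD_ofSheet hE X (F c) (hsh c hc) 𝒟 h𝒟

/-- **The crux `UniversalWitnessFamily` from `MGHDExists` (9937), `SubdataDevelopmentsEmbed` (10053) and the five stub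
statements of skeleton v5** (far gluing, universal socket bag, socket dilation, transport-and-patch, sheet breathing —
the registered signatures verbatim): `sheetBurial_of` gives the family; `MGHDExists` the ∃-MGHD conjunct and
`settlesInEveryMGHD_ofSheet` the ∀-MGHD conjunct of the summit conclusion for every member off `c = 0`. CONDITIONAL
(credits nothing by itself; it is the certificate that the registered stubs close the crux). [folklore] -/
theorem universalWitnessFamily_of_sheetLine :
    MGHDExists → SubdataDevelopmentsEmbed →
    (∀ (X : Type) [TopologicalSpace X] [ChartedSpace E3 X] [IsManifold (𝓡 3) ∞ X] [T2Space X]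
      [SecondCountableTopology X] [ConnectedSpace X], ∀ d ∈ admissibleVacuumData X,
      ∃ (η : ℝ) (e : AFEnd X) (Rstar : ℝ) (m : ℝ → ℝ) (G : ℝ → InitialDataSet (𝓡 3) X),
        0 < η ∧ e.IsSoleEnd ∧ e.R < Rstar ∧ ContDiff ℝ ∞ m ∧
        SmoothSectionsOn 𝓘(ℝ, ℝ) G {p : ℝ × X | Rstar < p.1} ∧
        ∀ R : ℝ, Rstar < R → G R ∈ admissibleVacuumData X ∧ (∀ x ∉ e.far R, AgreeAt (G R) d x) ∧
          η * R ≤ m R ∧ IsExactSchwarzschildBeyond e (G R) (m R) (32 * R)) →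
    (∀ μ₀ : ℝ, 0 < μ₀ → ∃ μ : ℝ, 0 < μ ∧ μ ≤ μ₀ ∧
      ∃ (M : ℝ) (C : InitialDataSet (𝓡 3) E3), 4 < M ∧
        VacuumOn {y : E3 | 1 < ‖y‖} C ∧ IsSchwarzschildAnnulus C μ ∧ IsIsotropicBeyond M (M / 2) C) →
    (∀ (C : InitialDataSet (𝓡 3) E3) (μ M : ℝ), 0 < μ → 4 < M →
      VacuumOn {y : E3 | 1 < ‖y‖} C → IsSchwarzschildAnnulus C μ → IsIsotropicBeyond M (M / 2) C →
      ∃ Cfam : ℝ → InitialDataSet (𝓡 3) E3,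
        SmoothSectionsOn 𝓘(ℝ, ℝ) Cfam {p : ℝ × E3 | 0 < p.1} ∧
        ∀ l : ℝ, 0 < l →
          VacuumOn {y : E3 | l < ‖y‖} (Cfam l) ∧
          (∀ y : E3, l < ‖y‖ → ‖y‖ < 2 * l →
            (Cfam l).h.inner y = (1 + l * μ / (2 * ‖y‖)) ^ 4 • (innerSL ℝ : E3 →L[ℝ] E3 →L[ℝ] ℝ) ∧
              (Cfam l).k y = 0) ∧
          IsIsotropicBeyond (l * M) (l * M / 2) (Cfam l)) →
    (∀ (X : Type) [TopologicalSpace X] [ChartedSpace E3 X] [IsManifold (𝓡 3) ∞ X] [T2Space X]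
      [SecondCountableTopology X] [ConnectedSpace X] (e : AFEnd X) (Rstar η μ M : ℝ) (m : ℝ → ℝ)
      (G : ℝ → InitialDataSet (𝓡 3) X) (Cfam : ℝ → InitialDataSet (𝓡 3) E3),
      e.IsSoleEnd → e.R < Rstar → 0 < μ → 32 * μ ≤ η → 4 < M → ContDiff ℝ ∞ m →
      SmoothSectionsOn 𝓘(ℝ, ℝ) G {p : ℝ × X | Rstar < p.1} →
      (∀ R : ℝ, Rstar < R → G R ∈ admissibleVacuumData X ∧ η * R ≤ m R ∧
        IsExactSchwarzschildBeyond e (G R) (m R) (32 * R)) →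
      SmoothSectionsOn 𝓘(ℝ, ℝ) Cfam {p : ℝ × E3 | 0 < p.1} →
      (∀ l : ℝ, 0 < l →
        VacuumOn {y : E3 | l < ‖y‖} (Cfam l) ∧
        (∀ y : E3, l < ‖y‖ → ‖y‖ < 2 * l →
          (Cfam l).h.inner y = (1 + l * μ / (2 * ‖y‖)) ^ 4 • (innerSL ℝ : E3 →L[ℝ] E3 →L[ℝ] ℝ) ∧
            (Cfam l).k y = 0) ∧
        IsIsotropicBeyond (l * M) (l * M / 2) (Cfam l)) →
      ∃ P : ℝ → InitialDataSet (𝓡 3) X, SmoothSectionsOn 𝓘(ℝ, ℝ) P {p : ℝ × X | Rstar < p.1} ∧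
        ∀ R : ℝ, Rstar < R → P R ∈ admissibleVacuumData X ∧
          (∃ (M' : ℝ) (hM' : 0 < M') (Φ : Schwarzschild.isotropicExterior M' → X)
            (hΦ : ContMDiff (𝓡 3) (𝓡 3) (∞ + 1) Φ) (hΦ' : ∀ u, Function.Injective (mfderiv (𝓡 3) (𝓡 3) Φ u)),
            Topology.IsOpenEmbedding Φ ∧
            (∀ R' : ℝ, M' / 2 ≤ R' →
              IsCompact (Φ '' {y : Schwarzschild.isotropicExterior M' | R' < ‖(y : E3)‖})ᶜ) ∧
            (P R).comap Φ hΦ hΦ' = Schwarzschild.timeSymmetricExteriorData M' hM'.le) ∧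
          ∀ x ∉ e.far (32 * R), AgreeAt (P R) (G R) x) →
    (∀ (X : Type) [TopologicalSpace X] [ChartedSpace E3 X] [IsManifold (𝓡 3) ∞ X] [T2Space X]
      [SecondCountableTopology X] [ConnectedSpace X] (d : InitialDataSet (𝓡 3) X) (e : AFEnd X) (Rstar : ℝ)
      (P : ℝ → InitialDataSet (𝓡 3) X), e.R < Rstar →
      SmoothSectionsOn 𝓘(ℝ, ℝ) P {p : ℝ × X | Rstar < p.1} →
      (∀ R : ℝ, Rstar < R → P R ∈ admissibleVacuumData X ∧
        (∃ (M' : ℝ) (hM' : 0 < M') (Φ : Schwarzschild.isotropicExterior M' → X)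
          (hΦ : ContMDiff (𝓡 3) (𝓡 3) (∞ + 1) Φ) (hΦ' : ∀ u, Function.Injective (mfderiv (𝓡 3) (𝓡 3) Φ u)),
          Topology.IsOpenEmbedding Φ ∧
          (∀ R' : ℝ, M' / 2 ≤ R' →
            IsCompact (Φ '' {y : Schwarzschild.isotropicExterior M' | R' < ‖(y : E3)‖})ᶜ) ∧
          (P R).comap Φ hΦ hΦ' = Schwarzschild.timeSymmetricExteriorData M' hM'.le) ∧
        ∀ x ∉ e.far R, AgreeAt (P R) d x) →
      ∃ (S : ℝ × ℝ → InitialDataSet (𝓡 3) X) (E : ℝ → InitialDataSet (𝓡 3) X) (x₀ : X)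
        (v₀ : TangentSpace (𝓡 3) x₀),
        SmoothSectionsOn (𝓘(ℝ, ℝ).prod 𝓘(ℝ, ℝ)) S {p : (ℝ × ℝ) × X | Rstar < p.1.1} ∧
        SmoothSectionsOn 𝓘(ℝ, ℝ) E (Set.univ : Set (ℝ × X)) ∧ E 0 = d ∧
        (∀ R t : ℝ, Rstar < R → ∀ x ∉ e.far R, AgreeAt (S (R, t)) (E t) x) ∧ x₀ ∉ e.far Rstar ∧
        Set.InjOn (fun t : ℝ ↦ (E t).h.inner x₀ v₀ v₀) (Set.Ioo (-1) 1) ∧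
        ∀ R t : ℝ, Rstar < R → |t| < 1 → S (R, t) ∈ admissibleVacuumData X ∧
          ∃ (M' : ℝ) (hM' : 0 < M') (Φ : Schwarzschild.isotropicExterior M' → X)
            (hΦ : ContMDiff (𝓡 3) (𝓡 3) (∞ + 1) Φ) (hΦ' : ∀ u, Function.Injective (mfderiv (𝓡 3) (𝓡 3) Φ u)),
            Topology.IsOpenEmbedding Φ ∧
            (∀ R' : ℝ, M' / 2 ≤ R' →
              IsCompact (Φ '' {y : Schwarzschild.isotropicExterior M' | R' < ‖(y : E3)‖})ᶜ) ∧
            (S (R, t)).comap Φ hΦ hΦ' = Schwarzschild.timeSymmetricExteriorData M' hM'.le) →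
    UniversalWitnessFamily :=
  fun hM hE hA hU hDil hPatch hBr ↦
    universalWitnessFamily_of_sheetBurial hM hE (sheetBurial_of hA hU hDil hPatch hBr)

end Summit.FinalStateConjecture.FinalStateConjecture.Theorems.SwallowTheDatum.UniversalWitnessFamily.SheetLine

end
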